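import Summits.ResolutionOfSingularities.ResolutionOfSingularities.Theorems.WeightedInvariantIota3DropCurveTieLocus
import Summits.ResolutionOfSingularities.ResolutionOfSingularities.Theorems.WeightedInvariantIota3TieLocusNormal
import Summits.ResolutionOfSingularities.ResolutionOfSingularities.Theorems.WeightedInvariantKeyRungThreeOfDropCurveFracTie
import HarnessLib

/-!
# The gap list of `stub_keyRungGrHomLE_three` cut to hD + (D-b³-point) + (D-b³-curve-FRAC-TIE-ZERO): ONE successor ring per fractional tied
# curve centre (door `HypersurfaceCentreConstruction`, stmt-ResolutionOfSingularities-19897)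

Helper for `stub_keyRungGrHomLE_three` (def-free, `--supports 19897`).  Final assembly of hand -9's files: …P3aTieLocus (tie locus),
…P3aTieLocusPin (the pin), …Iota3DropCurveTieLocus (`ι₃ᵗ` currency), …Iota3TieLocusNormal (at a FRACTIONAL-slope curve centre the AQS-adapted
normal form `f = c y^ν + h` forces `λ ∈ 𝔪` and empties the `X = 0` locus), on top of hand -8's …KeyRungThreeOfDropCurveFracTie and
`Iota3.mem_span_pow_sup_of_curve_lexMax_frac`.

* **`Iota3.dropb_curve_or_tiePointZero_aux`**, **`Iota3.dropb3_curve_or_tiePointZero`** — integer weights `(b, 1)`, `f = c y^ν + h` (`c` unit,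
  `h ∈ 𝒥_{bν+1}((y,x);(b,1))`): for every presentation `(u, w)` of `𝒥((y,x);(b,1))`, at every `t`-homogeneous successor over the closed point off the
  vertex: `ι₃ᵗ` drops, OR `f ∈ 𝒥_{(b+1)ν}((x, y, z); (1, b+1, 1))` and `𝔫 = (t⁻¹, z, Y)`, `y = (t⁻¹)^b Y`, a regular local threefold with regular
  system of parameters `(t⁻¹, z, Y)/1`.
* **`Iota3.dropb3_of_point_curveFracTieZero`**, **`keyRungGrHomLE_three_of_tieDescent_point_curveFracTieZero`** (GAP LIST OF RECORD),
  **`keyRungGrHomLE_three_of_c11_point_curveFracTieZero`** — `KeyRungGrHomLE 3 p ⟸` hD (resp. (c11)≤3) + (D-b³-point) [the crux] +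
  **(D-b³-curve-FRAC-TIE-ZERO)**: at a curve centre `P = (x, y)` of a three-dimensional door position with `S`-presented AQS germ
  `(y/1, x/1; r, q; rν)`, `q ≥ 2`, `b = ⌊r/q⌋ ≥ 1`, `J₃ᵗ = 𝒥((y,x);(b,1))`, `f ∈ 𝒥_{bν} ∩ 𝔪^ν ∖ 𝔪^{ν+1}` AND `f ∈ 𝒥_{(b+1)ν}((x, y, z); (1, b+1, 1))`
  (the tie at `λ = 0`), for every presentation `(u, w)` of `J₃ᵗ`, the `ι₃ᵗ`-drop `ι₃ᵗ(B_𝔫)(g/1) < ι₃ᵗ(S)(f)` at THE ONE `t`-homogeneous successor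
  `𝔫 = (t⁻¹, z, Y)` (`y = (t⁻¹)^b Y`; `B_𝔫` regular local of Krull dimension `3`, `(t⁻¹, z, Y)/1` a regular system of parameters — handed over).
So the curve regime of (D-b³) is reduced to a `σ`-comparison at ONE explicit regular local threefold per curve centre (CURVE-TIE.md §3 (ii)).
[OURS · L1 W4.3 · audit glue; AI work, weaker than expert review; nothing here is a statement of the manuscript under review.]

## References

* D. Abramovich, M. H. Quek, B. Schober, arXiv:2507.01232 (2025), Thm 1.3 (3), Thm 3.5. [AbramovichQuekSchober2025]
* J. Włodarczyk, *Functorial resolution by torus actions*, arXiv:2203.03090, §2.3.9. [Wlodarczyk2022]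
-/

noncomputable section

set_option linter.dupNamespace false -- mandated namespace of this single-conjunct summit

open IsLocalRing Literature.AlgebraicGeometry.Resolution
open Summit.ResolutionOfSingularities.ResolutionOfSingularities.Theorems
open Summit.ResolutionOfSingularities.ResolutionOfSingularities.Theorems.ContactCylinder

namespace Summit.ResolutionOfSingularities.ResolutionOfSingularities.Cruxes.HypersurfaceCentreConstruction.LocalEngine

namespace Iota3

/-- Carrier transport for the ZERO form (integer weights `(b, 1)`, AQS-adapted normal form `f = c y^ν + h`): on the extended Rees algebra of ANY
filtration equal to `𝒥((y,x);(b,1))`, at a `t`-homogeneous successor over the closed point off the vertex, `ι₃ᵗ` drops OR `f` is tied at `λ = 0` and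
`𝔫 = (t⁻¹, z, Y)` (`y = (t⁻¹)^b Y`) is a regular local threefold with regular system of parameters `(t⁻¹, z, Y)/1`. [OURS · L1 W4.3 · seam] -/
theorem dropb_curve_or_tiePointZero_aux {S : Type} [CommRing S] [IsRegularLocalRing S] {y x z : S} {b ν : ℕ} {f c h : S}
    (hyxz : Ideal.span (Set.range ![y, x, z]) = maximalIdeal S) (hd : (maximalIdeal S).spanFinrank = 3)
    (hdim : ringKrullDim S = (3 : ℕ)) [hP : (Ideal.span (Set.range ![y, x])).IsPrime] (hb : 1 ≤ b) (hν : 1 ≤ ν)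
    (hfν0 : f ∈ maximalIdeal S ^ ν) (hfν : f ∉ maximalIdeal S ^ (ν + 1))
    (hadm : f ∈ weightedMonomialIdeal ![y, x] ![b, 1] (b * ν)) (hc : IsUnit c)
    (hh : h ∈ weightedMonomialIdeal ![y, x] ![b, 1] (b * ν + 1)) (hf : f = c * y ^ ν + h)
    {I : ℕ → Ideal S} (hI : I = weightedMonomialIdeal ![y, x] ![b, 1]) (P : Ideal S) :
    ∀ (𝔫 : Ideal (extReesAlgebra I)) [𝔫.IsPrime],
      Ideal.span {e | e ∈ 𝔫 ∧ SetLike.IsHomogeneousElem (KWildHom.tPiece (extReesAlgebra I)) e} = 𝔫 →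
      extReesAlgebra.tInv I ∈ 𝔫 →
      P.map (algebraMap S (extReesAlgebra I)) ≤ 𝔫 →
      ¬ extReesAlgebra.vertexIdeal I ≤ 𝔫 →
      maximalIdeal S ≤ 𝔫.comap (algebraMap S (extReesAlgebra I)) →
      ∀ (a : ℕ) (g : extReesAlgebra I),
        algebraMap S (extReesAlgebra I) f = extReesAlgebra.tInv I ^ a * g →
        ¬ extReesAlgebra.tInv I ∣ g →
        iotaFlatT (Localization.AtPrime 𝔫) (algebraMap (extReesAlgebra I) (Localization.AtPrime 𝔫) g) < iotaFlatT S f ∨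
        (f ∈ weightedMonomialIdeal ![x, y, z] ![1, b + 1, 1] ((b + 1) * ν) ∧
          ∃ W : extReesAlgebra I, algebraMap S (extReesAlgebra I) y = extReesAlgebra.tInv I ^ b * W ∧
            𝔫 = Ideal.span {extReesAlgebra.tInv I, algebraMap S (extReesAlgebra I) z, W} ∧
            IsRegularLocalRing (Localization.AtPrime 𝔫) ∧ ringKrullDim (Localization.AtPrime 𝔫) = (3 : ℕ) ∧
            Ideal.span {algebraMap _ (Localization.AtPrime 𝔫) (extReesAlgebra.tInv I),
              algebraMap _ (Localization.AtPrime 𝔫) (algebraMap S (extReesAlgebra I) z),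
              algebraMap _ (Localization.AtPrime 𝔫) W} = maximalIdeal (Localization.AtPrime 𝔫)) := by
  subst hI
  haveI := isDomain_of_isRegularLocalRing S
  have hν' : (ν : Ordinal.{0}) ≤ iotaOrd S f := (natCast_le_iotaOrd_iff S f ν).mpr hfν0
  have hxyz : Ideal.span {x, y, z} = maximalIdeal S := by rw [← hyxz, range_three, Set.insert_comm]
  intro 𝔫 _ hhom hT _ hV hM a g hfg hTg
  have hz : algebraMap S _ z ∈ 𝔫 := hM (hyxz ▸ Ideal.subset_span ⟨2, rfl⟩)
  rcases LocalGameEFTCylinder.notMem_pow_transform_or_tieLocus hyxz hd Nat.one_pos hb (Nat.coprime_one_right _) hν hfν hadm 𝔫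
      hT hz hV hfg hTg with h1 | ⟨lam, -, hft, hW, hX⟩ | ⟨-, hb1, hft, -, -⟩
  · exact Or.inl (iotaFlatT_lt_of_iotaOrd_lt _ _ _ _
      (lt_of_lt_of_le (LocalGameEFTFace.iotaOrd_lt_of_notMem_pow h1) hν'))
  · -- the tie forces `lam ∈ 𝔪`; then the pinned point is `(t⁻¹, z, Y)` and the tie ideal is that of `λ = 0`
    have hlam : lam ∈ maximalIdeal S := mem_maximalIdeal_of_mem_tie_of_normalForm hyxz hdim hb hν hc hh hf hft
    have hft0 : f ∈ weightedMonomialIdeal ![x, y, z] ![1, b + 1, 1] ((b + 1) * ν) := by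
      rw [← weightedMonomialIdeal_steep_eq_of_mem_maximalIdeal hxyz hb hlam]; exact hft
    have hlam𝔫 : algebraMap S _ lam ∈ 𝔫 := hM hlam
    have hY : LocalGameEFTPointMove.uT ![y, x] ![b, 1] 0 ∈ 𝔫 := by
      have h2 := Ideal.add_mem _ hW (Ideal.mul_mem_right (LocalGameEFTPointMove.uT ![y, x] ![b, 1] 1 ^ b) _ hlam𝔫)
      rwa [sub_add_cancel] at h2
    have hY' : LocalGameEFTPointMove.uT ![y, x] ![b, 1] 0 -
        algebraMap S _ (0 : S) * LocalGameEFTPointMove.uT ![y, x] ![b, 1] 1 ^ b ∈ 𝔫 := by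
      rw [map_zero, zero_mul, sub_zero]; exact hY
    have hpin := LocalGameEFTCylinder.eq_span_triple_of_isTHomogeneous_of_tieCurve hyxz hd Nat.one_pos hb 𝔫 hhom hT hz
      (lam := 0) (Or.inl rfl) hY' hX
    have hreg := LocalGameEFTCylinder.isRegularLocalRing_of_tieCurve hyxz hd Nat.one_pos hb 𝔫 hhom hT hz (lam := 0) (Or.inl rfl) hY' hX
    rw [map_zero, zero_mul, sub_zero] at hpin hreg
    exact Or.inr ⟨hft0, _, LocalGameEFTCylinder.algebraMap_y_eq, hpin, hreg⟩
  · -- the `X = 0` locus is empty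
    subst hb1
    exact absurd hft (not_mem_weightedMonomialIdeal_X_of_normalForm hyxz hdim hν hc hh hf)

/-- **(D-b³-curve) OR THE ONE PINNED POINT `(t⁻¹, z, Y)`, for EVERY presentation** (binder shape of (D-b³); integer weights `(b, 1)` with the
AQS-adapted normal form `f = c y^ν + h`, `c` a unit, `h ∈ 𝒥_{bν+1}((y,x);(b,1))`). [OURS · L1 W4.3 · (D-b³-curve-FRAC-TIE) (i)]
[cite: AbramovichQuekSchober2025, Thm 1.3 (3)] [cite: Wlodarczyk2022, §2.3.9] -/
theorem dropb3_curve_or_tiePointZero {S : Type} [CommRing S] [IsRegularLocalRing S] {y x z : S} {b ν : ℕ} {f c h : S}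
    (hyxz : Ideal.span (Set.range ![y, x, z]) = maximalIdeal S) (hd : (maximalIdeal S).spanFinrank = 3)
    (hdim : ringKrullDim S = (3 : ℕ)) [hP : (Ideal.span (Set.range ![y, x])).IsPrime] (hb : 1 ≤ b) (hν : 1 ≤ ν)
    (hfν0 : f ∈ maximalIdeal S ^ ν) (hfν : f ∉ maximalIdeal S ^ (ν + 1))
    (hadm : f ∈ weightedMonomialIdeal ![y, x] ![b, 1] (b * ν)) (hc : IsUnit c)
    (hh : h ∈ weightedMonomialIdeal ![y, x] ![b, 1] (b * ν + 1)) (hf : f = c * y ^ ν + h)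
    {n : ℕ} (u : Fin n → S) (w : Fin n → ℕ) (hpres : ∀ m : ℕ, weightedMonomialIdeal u w m = weightedMonomialIdeal ![y, x] ![b, 1] m) :
    ∀ (𝔫 : Ideal (cobordantAlgebra' u w)) [𝔫.IsPrime], IsTHomogeneous u w 𝔫 → cobordantT' u w ∈ 𝔫 →
      (maximalIdeal S).map (algebraMap S (cobordantAlgebra' u w)) ≤ 𝔫 →
      ¬ extReesAlgebra.vertexIdeal (weightedMonomialIdeal u w) ≤ 𝔫 →
      ∀ (a : ℕ) (g : cobordantAlgebra' u w), algebraMap S (cobordantAlgebra' u w) f = cobordantT' u w ^ a * g →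
        ¬ cobordantT' u w ∣ g →
        algebraMap (cobordantAlgebra' u w) (Localization.AtPrime 𝔫) g ∈ maximalIdeal (Localization.AtPrime 𝔫) ^ 2 →
        iotaFlatT (Localization.AtPrime 𝔫) (algebraMap (cobordantAlgebra' u w) (Localization.AtPrime 𝔫) g) < iotaFlatT S f ∨
        (f ∈ weightedMonomialIdeal ![x, y, z] ![1, b + 1, 1] ((b + 1) * ν) ∧
          ∃ W : cobordantAlgebra' u w, algebraMap S (cobordantAlgebra' u w) y = cobordantT' u w ^ b * W ∧
            𝔫 = Ideal.span {cobordantT' u w, algebraMap S (cobordantAlgebra' u w) z, W} ∧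
            IsRegularLocalRing (Localization.AtPrime 𝔫) ∧ ringKrullDim (Localization.AtPrime 𝔫) = (3 : ℕ) ∧
            Ideal.span {algebraMap _ (Localization.AtPrime 𝔫) (cobordantT' u w),
              algebraMap _ (Localization.AtPrime 𝔫) (algebraMap S (cobordantAlgebra' u w) z),
              algebraMap _ (Localization.AtPrime 𝔫) W} = maximalIdeal (Localization.AtPrime 𝔫)) := by
  intro 𝔫 _ hhom hT hM hV a g hfg hTg _
  exact dropb_curve_or_tiePointZero_aux hyxz hd hdim hb hν hfν0 hfν hadm hc hh hf (funext hpres) (maximalIdeal S) 𝔫 hhom hT hM hV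
    (Ideal.map_le_iff_le_comap.mp hM) a g hfg hTg

/-- **(D-b³) ⟸ (D-b³-point) + (D-b³-curve-FRAC-TIE-ZERO).** [OURS · L1 W4.3 · (D-b³) split] [cite: AbramovichQuekSchober2025, Thm 1.3 (3), Thm 3.5]
[cite: Wlodarczyk2022, §2.3.9] -/
theorem dropb3_of_point_curveFracTieZero (p : ℕ)
    (hPOINT : ∀ (k₀ : Type) [Field k₀] [CharP k₀ p] [PerfectField k₀]
      (S : Type) [CommRing S] [Algebra k₀ S] [Algebra.EssFiniteType k₀ S] [IsRegularLocalRing S]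
      (f : S), ringKrullDim S = 3 → f ≠ 0 → f ∈ (maximalIdeal S) ^ 2 →
      ∀ (P : Ideal S) [P.IsPrime], IsRegularLocalRing (S ⧸ P) → f ∈ P →
        topStratum iotaOrdEpsTau S f = {𝔮 | P ≤ 𝔮.asIdeal} → ¬ ringKrullDim (Localization.AtPrime P) ≤ 1 →
        P = maximalIdeal S →
        ∀ (n : ℕ) (u : Fin n → S) (w : Fin n → ℕ),
          Ideal.span (Set.range u) = maximalIdeal S → (maximalIdeal S).spanFinrank = n → (∃ i, 0 < w i) →
          Ideal.span {x | ∃ i, 0 < w i ∧ x = u i} = P →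
          (∀ m : ℕ, weightedMonomialIdeal u w m = jFlatT S f m) →
          ∀ (𝔫 : Ideal (cobordantAlgebra' u w)) [𝔫.IsPrime], IsTHomogeneous u w 𝔫 → cobordantT' u w ∈ 𝔫 →
            (maximalIdeal S).map (algebraMap S (cobordantAlgebra' u w)) ≤ 𝔫 →
            ¬ extReesAlgebra.vertexIdeal (weightedMonomialIdeal u w) ≤ 𝔫 →
            ∀ (a : ℕ) (g : cobordantAlgebra' u w), algebraMap S (cobordantAlgebra' u w) f = cobordantT' u w ^ a * g →
              ¬ cobordantT' u w ∣ g →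
              algebraMap (cobordantAlgebra' u w) (Localization.AtPrime 𝔫) g ∈ maximalIdeal (Localization.AtPrime 𝔫) ^ 2 →
              iotaFlatT (Localization.AtPrime 𝔫) (algebraMap (cobordantAlgebra' u w) (Localization.AtPrime 𝔫) g) <
                iotaFlatT S f)
    (hCURVEFRACTIEZERO : ∀ (k₀ : Type) [Field k₀] [CharP k₀ p] [PerfectField k₀]
      (S : Type) [CommRing S] [Algebra k₀ S] [Algebra.EssFiniteType k₀ S] [IsRegularLocalRing S]
      (f : S), ringKrullDim S = 3 → f ≠ 0 → f ∈ (maximalIdeal S) ^ 2 →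
      ∀ (P : Ideal S) [P.IsPrime], IsRegularLocalRing (S ⧸ P) → f ∈ P →
        topStratum iotaOrdEpsTau S f = {𝔮 | P ≤ 𝔮.asIdeal} → ¬ ringKrullDim (Localization.AtPrime P) ≤ 1 →
        P ≠ maximalIdeal S →
        ∀ (x y z : S) (q r ν : ℕ) (_ : (Ideal.span ({x, y} : Set S)).IsPrime), Ideal.span {x, y, z} = maximalIdeal S →
          P = Ideal.span {x, y} → 2 ≤ q → q ≤ r → 1 ≤ ν → f ∈ maximalIdeal S ^ ν → f ∉ maximalIdeal S ^ (ν + 1) →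
          IsLexMaxWeightedCentreGerm (Localization.AtPrime (Ideal.span ({x, y} : Set S)))
            (Ideal.span {algebraMap S (Localization.AtPrime (Ideal.span ({x, y} : Set S))) f})
            ![algebraMap S (Localization.AtPrime (Ideal.span ({x, y} : Set S))) y,
              algebraMap S (Localization.AtPrime (Ideal.span ({x, y} : Set S))) x] ![r, q] (r * ν) →
          1 ≤ r / q → f ∈ weightedMonomialIdeal ![y, x] ![r / q, 1] (r / q * ν) →
          (∀ m : ℕ, jFlatT S f m = weightedMonomialIdeal ![y, x] ![r / q, 1] m) →
        ∀ (n : ℕ) (u : Fin n → S) (w : Fin n → ℕ),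
          Ideal.span (Set.range u) = maximalIdeal S → (maximalIdeal S).spanFinrank = n → (∃ i, 0 < w i) →
          Ideal.span {x | ∃ i, 0 < w i ∧ x = u i} = P →
          (∀ m : ℕ, weightedMonomialIdeal u w m = jFlatT S f m) →
          ∀ (𝔫 : Ideal (cobordantAlgebra' u w)) [𝔫.IsPrime], IsTHomogeneous u w 𝔫 → cobordantT' u w ∈ 𝔫 →
            (maximalIdeal S).map (algebraMap S (cobordantAlgebra' u w)) ≤ 𝔫 →
            ¬ extReesAlgebra.vertexIdeal (weightedMonomialIdeal u w) ≤ 𝔫 →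
            ∀ (a : ℕ) (g : cobordantAlgebra' u w), algebraMap S (cobordantAlgebra' u w) f = cobordantT' u w ^ a * g →
              ¬ cobordantT' u w ∣ g →
              algebraMap (cobordantAlgebra' u w) (Localization.AtPrime 𝔫) g ∈ maximalIdeal (Localization.AtPrime 𝔫) ^ 2 →
              f ∈ weightedMonomialIdeal ![x, y, z] ![1, r / q + 1, 1] ((r / q + 1) * ν) →
              ∀ W : cobordantAlgebra' u w, algebraMap S (cobordantAlgebra' u w) y = cobordantT' u w ^ (r / q) * W →
                𝔫 = Ideal.span {cobordantT' u w, algebraMap S (cobordantAlgebra' u w) z, W} →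
                IsRegularLocalRing (Localization.AtPrime 𝔫) → ringKrullDim (Localization.AtPrime 𝔫) = (3 : ℕ) →
                Ideal.span {algebraMap _ (Localization.AtPrime 𝔫) (cobordantT' u w),
                  algebraMap _ (Localization.AtPrime 𝔫) (algebraMap S (cobordantAlgebra' u w) z),
                  algebraMap _ (Localization.AtPrime 𝔫) W} = maximalIdeal (Localization.AtPrime 𝔫) →
              iotaFlatT (Localization.AtPrime 𝔫) (algebraMap (cobordantAlgebra' u w) (Localization.AtPrime 𝔫) g) <
                iotaFlatT S f) :
    ∀ (k₀ : Type) [Field k₀] [CharP k₀ p] [PerfectField k₀]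
      (S : Type) [CommRing S] [Algebra k₀ S] [Algebra.EssFiniteType k₀ S] [IsRegularLocalRing S]
      (f : S), ringKrullDim S = 3 → f ≠ 0 → f ∈ (maximalIdeal S) ^ 2 →
      ∀ (P : Ideal S) [P.IsPrime], IsRegularLocalRing (S ⧸ P) → f ∈ P →
        topStratum iotaOrdEpsTau S f = {𝔮 | P ≤ 𝔮.asIdeal} → ¬ ringKrullDim (Localization.AtPrime P) ≤ 1 →
        ∀ (n : ℕ) (u : Fin n → S) (w : Fin n → ℕ),
          Ideal.span (Set.range u) = maximalIdeal S → (maximalIdeal S).spanFinrank = n → (∃ i, 0 < w i) →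
          Ideal.span {x | ∃ i, 0 < w i ∧ x = u i} = P →
          (∀ m : ℕ, weightedMonomialIdeal u w m = jFlatT S f m) →
          ∀ (𝔫 : Ideal (cobordantAlgebra' u w)) [𝔫.IsPrime], IsTHomogeneous u w 𝔫 → cobordantT' u w ∈ 𝔫 →
            (maximalIdeal S).map (algebraMap S (cobordantAlgebra' u w)) ≤ 𝔫 →
            ¬ extReesAlgebra.vertexIdeal (weightedMonomialIdeal u w) ≤ 𝔫 →
            ∀ (a : ℕ) (g : cobordantAlgebra' u w), algebraMap S (cobordantAlgebra' u w) f = cobordantT' u w ^ a * g →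
              ¬ cobordantT' u w ∣ g →
              algebraMap (cobordantAlgebra' u w) (Localization.AtPrime 𝔫) g ∈ maximalIdeal (Localization.AtPrime 𝔫) ^ 2 →
              iotaFlatT (Localization.AtPrime 𝔫) (algebraMap (cobordantAlgebra' u w) (Localization.AtPrime 𝔫) g) <
                iotaFlatT S f :=
  dropb3_of_point_curveFracTie p hPOINT
    fun k₀ _ _ _ S _ _ _ _ f hd hf0 hf2 P _ hreg hfP hE hP1 hPm x y z q r ν hPxy hxyz hPeq hq2 hqr hν1 hfν hfν1 hlex hb1 hadm hJ
      _ n u w h1 h2 h3 h4 h5 => by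
    classical
    have hd3 : ringKrullDim S = (3 : ℕ) := by rw [hd]; rfl
    have hrk : (maximalIdeal S).spanFinrank = 3 := by
      have h := IsRegularLocalRing.spanFinrank_maximalIdeal (R := S)
      rw [hd3] at h
      exact_mod_cast h
    haveI hPyx : (Ideal.span (Set.range ![y, x])).IsPrime := by
      rw [show Set.range ![y, x] = {y, x} by
        rw [Matrix.range_cons, Matrix.range_cons, Matrix.range_empty, Set.union_empty, Set.singleton_union], Ideal.span_pair_comm,
        ← hPeq]
      infer_instance
    have hyxz : Ideal.span (Set.range ![y, x, z]) = maximalIdeal S := by rw [range_three, Set.insert_comm]; exact hxyz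
    -- the AQS-adapted normal form `f = c y^ν + h` (hand -8's first reduction + unit cofactor)
    obtain ⟨_, hlex'⟩ := exists_isLexMax_of_eq hPeq.symm hlex
    have hcop' : Nat.Coprime r q := by simpa using hlex'.2.2.1
    have hndvd : ¬ q ∣ r := fun hdvd => by
      have h1 : Nat.gcd r q = 1 := hcop'
      rw [Nat.gcd_eq_right hdvd] at h1
      omega
    have hsup := mem_span_pow_sup_of_curve_lexMax_frac hd P hPeq.symm hxyz hν1 hndvd hlex'
    obtain ⟨c, h, hc, hh, hf⟩ := exists_normalForm_of_mem_sup hyxz hb1 hsup hfν1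
    intro 𝔫 _ hhom hT hM hV a g hfg hTg hg2
    rcases dropb3_curve_or_tiePointZero hyxz hrk hd3 hb1 hν1 hfν hfν1 hadm hc hh hf u w (fun m => by rw [h5 m, hJ m]) 𝔫 hhom hT
        hM hV a g hfg hTg hg2 with hlt | ⟨hft0, W, hW, h𝔫, hR1, hR2, hR3⟩
    · exact hlt
    · exact hCURVEFRACTIEZERO k₀ S f hd hf0 hf2 P hreg hfP hE hP1 hPm x y z q r ν hPxy hxyz hPeq hq2 hqr hν1 hfν hfν1 hlex hb1
        hadm hJ n u w h1 h2 h3 h4 h5 𝔫 hhom hT hM hV a g hfg hTg hg2 hft0 W hW h𝔫 hR1 hR2 hR3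

end Iota3

open Iota3

/-- **GAP LIST OF RECORD for `stub_keyRungGrHomLE_three` — hD + (D-b³-point) + (D-b³-curve-FRAC-TIE-ZERO)** (module docstring): the curve
regime costs ONE `σ`-comparison at the regular local threefold `B_𝔫`, `𝔫 = (t⁻¹, z, y t^b)`, per fractional-slope curve centre tied at `λ = 0`.
[OURS · L1 W4.3 · audit glue] -/
theorem keyRungGrHomLE_three_of_tieDescent_point_curveFracTieZero (p : ℕ)
    (hD : ∀ (T T' : Type) [CommRing T] [IsRegularLocalRing T] [CommRing T'] [IsRegularLocalRing T'] [Algebra T T']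
      [IsLocalHom (algebraMap T T')] [Algebra.FormallySmooth T T'] [Algebra.EssFiniteType T T'] (g : T),
      ringKrullDim T' ≤ 3 → IsTiePosition T' (algebraMap T T' g) → IsTiePosition T g)
    (hPOINT : ∀ (k₀ : Type) [Field k₀] [CharP k₀ p] [PerfectField k₀]
      (S : Type) [CommRing S] [Algebra k₀ S] [Algebra.EssFiniteType k₀ S] [IsRegularLocalRing S]
      (f : S), ringKrullDim S = 3 → f ≠ 0 → f ∈ (maximalIdeal S) ^ 2 →
      ∀ (P : Ideal S) [P.IsPrime], IsRegularLocalRing (S ⧸ P) → f ∈ P →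
        topStratum iotaOrdEpsTau S f = {𝔮 | P ≤ 𝔮.asIdeal} → ¬ ringKrullDim (Localization.AtPrime P) ≤ 1 →
        P = maximalIdeal S →
        ∀ (n : ℕ) (u : Fin n → S) (w : Fin n → ℕ),
          Ideal.span (Set.range u) = maximalIdeal S → (maximalIdeal S).spanFinrank = n → (∃ i, 0 < w i) →
          Ideal.span {x | ∃ i, 0 < w i ∧ x = u i} = P →
          (∀ m : ℕ, weightedMonomialIdeal u w m = jFlatT S f m) →
          ∀ (𝔫 : Ideal (cobordantAlgebra' u w)) [𝔫.IsPrime], IsTHomogeneous u w 𝔫 → cobordantT' u w ∈ 𝔫 →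
            (maximalIdeal S).map (algebraMap S (cobordantAlgebra' u w)) ≤ 𝔫 →
            ¬ extReesAlgebra.vertexIdeal (weightedMonomialIdeal u w) ≤ 𝔫 →
            ∀ (a : ℕ) (g : cobordantAlgebra' u w), algebraMap S (cobordantAlgebra' u w) f = cobordantT' u w ^ a * g →
              ¬ cobordantT' u w ∣ g →
              algebraMap (cobordantAlgebra' u w) (Localization.AtPrime 𝔫) g ∈ maximalIdeal (Localization.AtPrime 𝔫) ^ 2 →
              iotaFlatT (Localization.AtPrime 𝔫) (algebraMap (cobordantAlgebra' u w) (Localization.AtPrime 𝔫) g) <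
                iotaFlatT S f)
    (hCURVEFRACTIEZERO : ∀ (k₀ : Type) [Field k₀] [CharP k₀ p] [PerfectField k₀]
      (S : Type) [CommRing S] [Algebra k₀ S] [Algebra.EssFiniteType k₀ S] [IsRegularLocalRing S]
      (f : S), ringKrullDim S = 3 → f ≠ 0 → f ∈ (maximalIdeal S) ^ 2 →
      ∀ (P : Ideal S) [P.IsPrime], IsRegularLocalRing (S ⧸ P) → f ∈ P →
        topStratum iotaOrdEpsTau S f = {𝔮 | P ≤ 𝔮.asIdeal} → ¬ ringKrullDim (Localization.AtPrime P) ≤ 1 →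
        P ≠ maximalIdeal S →
        ∀ (x y z : S) (q r ν : ℕ) (_ : (Ideal.span ({x, y} : Set S)).IsPrime), Ideal.span {x, y, z} = maximalIdeal S →
          P = Ideal.span {x, y} → 2 ≤ q → q ≤ r → 1 ≤ ν → f ∈ maximalIdeal S ^ ν → f ∉ maximalIdeal S ^ (ν + 1) →
          IsLexMaxWeightedCentreGerm (Localization.AtPrime (Ideal.span ({x, y} : Set S)))
            (Ideal.span {algebraMap S (Localization.AtPrime (Ideal.span ({x, y} : Set S))) f})
            ![algebraMap S (Localization.AtPrime (Ideal.span ({x, y} : Set S))) y,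
              algebraMap S (Localization.AtPrime (Ideal.span ({x, y} : Set S))) x] ![r, q] (r * ν) →
          1 ≤ r / q → f ∈ weightedMonomialIdeal ![y, x] ![r / q, 1] (r / q * ν) →
          (∀ m : ℕ, jFlatT S f m = weightedMonomialIdeal ![y, x] ![r / q, 1] m) →
        ∀ (n : ℕ) (u : Fin n → S) (w : Fin n → ℕ),
          Ideal.span (Set.range u) = maximalIdeal S → (maximalIdeal S).spanFinrank = n → (∃ i, 0 < w i) →
          Ideal.span {x | ∃ i, 0 < w i ∧ x = u i} = P →
          (∀ m : ℕ, weightedMonomialIdeal u w m = jFlatT S f m) →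
          ∀ (𝔫 : Ideal (cobordantAlgebra' u w)) [𝔫.IsPrime], IsTHomogeneous u w 𝔫 → cobordantT' u w ∈ 𝔫 →
            (maximalIdeal S).map (algebraMap S (cobordantAlgebra' u w)) ≤ 𝔫 →
            ¬ extReesAlgebra.vertexIdeal (weightedMonomialIdeal u w) ≤ 𝔫 →
            ∀ (a : ℕ) (g : cobordantAlgebra' u w), algebraMap S (cobordantAlgebra' u w) f = cobordantT' u w ^ a * g →
              ¬ cobordantT' u w ∣ g →
              algebraMap (cobordantAlgebra' u w) (Localization.AtPrime 𝔫) g ∈ maximalIdeal (Localization.AtPrime 𝔫) ^ 2 →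
              f ∈ weightedMonomialIdeal ![x, y, z] ![1, r / q + 1, 1] ((r / q + 1) * ν) →
              ∀ W : cobordantAlgebra' u w, algebraMap S (cobordantAlgebra' u w) y = cobordantT' u w ^ (r / q) * W →
                𝔫 = Ideal.span {cobordantT' u w, algebraMap S (cobordantAlgebra' u w) z, W} →
                IsRegularLocalRing (Localization.AtPrime 𝔫) → ringKrullDim (Localization.AtPrime 𝔫) = (3 : ℕ) →
                Ideal.span {algebraMap _ (Localization.AtPrime 𝔫) (cobordantT' u w),
                  algebraMap _ (Localization.AtPrime 𝔫) (algebraMap S (cobordantAlgebra' u w) z),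
                  algebraMap _ (Localization.AtPrime 𝔫) W} = maximalIdeal (Localization.AtPrime 𝔫) →
              iotaFlatT (Localization.AtPrime 𝔫) (algebraMap (cobordantAlgebra' u w) (Localization.AtPrime 𝔫) g) <
                iotaFlatT S f) :
    KeyRungGrHomLE 3 p :=
  keyRungGrHomLE_three_of_game p hD
    (canonicalGameClauseHomLE_three_of_dropb3 p (dropb3_of_point_curveFracTieZero p hPOINT hCURVEFRACTIEZERO))

/-- **GAP LIST OF RECORD, (c11)-form — (c11)≤3 + (D-b³-point) + (D-b³-curve-FRAC-TIE-ZERO).** [OURS · L1 W4.3 · audit glue] -/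
theorem keyRungGrHomLE_three_of_c11_point_curveFracTieZero (p : ℕ) (hc11 : IotaJEssSmoothCompatibleLE 3 iotaFlatT jFlatT)
    (hPOINT : ∀ (k₀ : Type) [Field k₀] [CharP k₀ p] [PerfectField k₀]
      (S : Type) [CommRing S] [Algebra k₀ S] [Algebra.EssFiniteType k₀ S] [IsRegularLocalRing S]
      (f : S), ringKrullDim S = 3 → f ≠ 0 → f ∈ (maximalIdeal S) ^ 2 →
      ∀ (P : Ideal S) [P.IsPrime], IsRegularLocalRing (S ⧸ P) → f ∈ P →
        topStratum iotaOrdEpsTau S f = {𝔮 | P ≤ 𝔮.asIdeal} → ¬ ringKrullDim (Localization.AtPrime P) ≤ 1 →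
        P = maximalIdeal S →
        ∀ (n : ℕ) (u : Fin n → S) (w : Fin n → ℕ),
          Ideal.span (Set.range u) = maximalIdeal S → (maximalIdeal S).spanFinrank = n → (∃ i, 0 < w i) →
          Ideal.span {x | ∃ i, 0 < w i ∧ x = u i} = P →
          (∀ m : ℕ, weightedMonomialIdeal u w m = jFlatT S f m) →
          ∀ (𝔫 : Ideal (cobordantAlgebra' u w)) [𝔫.IsPrime], IsTHomogeneous u w 𝔫 → cobordantT' u w ∈ 𝔫 →
            (maximalIdeal S).map (algebraMap S (cobordantAlgebra' u w)) ≤ 𝔫 →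
            ¬ extReesAlgebra.vertexIdeal (weightedMonomialIdeal u w) ≤ 𝔫 →
            ∀ (a : ℕ) (g : cobordantAlgebra' u w), algebraMap S (cobordantAlgebra' u w) f = cobordantT' u w ^ a * g →
              ¬ cobordantT' u w ∣ g →
              algebraMap (cobordantAlgebra' u w) (Localization.AtPrime 𝔫) g ∈ maximalIdeal (Localization.AtPrime 𝔫) ^ 2 →
              iotaFlatT (Localization.AtPrime 𝔫) (algebraMap (cobordantAlgebra' u w) (Localization.AtPrime 𝔫) g) <
                iotaFlatT S f)
    (hCURVEFRACTIEZERO : ∀ (k₀ : Type) [Field k₀] [CharP k₀ p] [PerfectField k₀]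
      (S : Type) [CommRing S] [Algebra k₀ S] [Algebra.EssFiniteType k₀ S] [IsRegularLocalRing S]
      (f : S), ringKrullDim S = 3 → f ≠ 0 → f ∈ (maximalIdeal S) ^ 2 →
      ∀ (P : Ideal S) [P.IsPrime], IsRegularLocalRing (S ⧸ P) → f ∈ P →
        topStratum iotaOrdEpsTau S f = {𝔮 | P ≤ 𝔮.asIdeal} → ¬ ringKrullDim (Localization.AtPrime P) ≤ 1 →
        P ≠ maximalIdeal S →
        ∀ (x y z : S) (q r ν : ℕ) (_ : (Ideal.span ({x, y} : Set S)).IsPrime), Ideal.span {x, y, z} = maximalIdeal S →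
          P = Ideal.span {x, y} → 2 ≤ q → q ≤ r → 1 ≤ ν → f ∈ maximalIdeal S ^ ν → f ∉ maximalIdeal S ^ (ν + 1) →
          IsLexMaxWeightedCentreGerm (Localization.AtPrime (Ideal.span ({x, y} : Set S)))
            (Ideal.span {algebraMap S (Localization.AtPrime (Ideal.span ({x, y} : Set S))) f})
            ![algebraMap S (Localization.AtPrime (Ideal.span ({x, y} : Set S))) y,
              algebraMap S (Localization.AtPrime (Ideal.span ({x, y} : Set S))) x] ![r, q] (r * ν) →
          1 ≤ r / q → f ∈ weightedMonomialIdeal ![y, x] ![r / q, 1] (r / q * ν) →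
          (∀ m : ℕ, jFlatT S f m = weightedMonomialIdeal ![y, x] ![r / q, 1] m) →
        ∀ (n : ℕ) (u : Fin n → S) (w : Fin n → ℕ),
          Ideal.span (Set.range u) = maximalIdeal S → (maximalIdeal S).spanFinrank = n → (∃ i, 0 < w i) →
          Ideal.span {x | ∃ i, 0 < w i ∧ x = u i} = P →
          (∀ m : ℕ, weightedMonomialIdeal u w m = jFlatT S f m) →
          ∀ (𝔫 : Ideal (cobordantAlgebra' u w)) [𝔫.IsPrime], IsTHomogeneous u w 𝔫 → cobordantT' u w ∈ 𝔫 →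
            (maximalIdeal S).map (algebraMap S (cobordantAlgebra' u w)) ≤ 𝔫 →
            ¬ extReesAlgebra.vertexIdeal (weightedMonomialIdeal u w) ≤ 𝔫 →
            ∀ (a : ℕ) (g : cobordantAlgebra' u w), algebraMap S (cobordantAlgebra' u w) f = cobordantT' u w ^ a * g →
              ¬ cobordantT' u w ∣ g →
              algebraMap (cobordantAlgebra' u w) (Localization.AtPrime 𝔫) g ∈ maximalIdeal (Localization.AtPrime 𝔫) ^ 2 →
              f ∈ weightedMonomialIdeal ![x, y, z] ![1, r / q + 1, 1] ((r / q + 1) * ν) →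
              ∀ W : cobordantAlgebra' u w, algebraMap S (cobordantAlgebra' u w) y = cobordantT' u w ^ (r / q) * W →
                𝔫 = Ideal.span {cobordantT' u w, algebraMap S (cobordantAlgebra' u w) z, W} →
                IsRegularLocalRing (Localization.AtPrime 𝔫) → ringKrullDim (Localization.AtPrime 𝔫) = (3 : ℕ) →
                Ideal.span {algebraMap _ (Localization.AtPrime 𝔫) (cobordantT' u w),
                  algebraMap _ (Localization.AtPrime 𝔫) (algebraMap S (cobordantAlgebra' u w) z),
                  algebraMap _ (Localization.AtPrime 𝔫) W} = maximalIdeal (Localization.AtPrime 𝔫) →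
              iotaFlatT (Localization.AtPrime 𝔫) (algebraMap (cobordantAlgebra' u w) (Localization.AtPrime 𝔫) g) <
                iotaFlatT S f) :
    KeyRungGrHomLE 3 p :=
  keyRungGrHomLE_three_of_c11_game p hc11
    (canonicalGameClauseHomLE_three_of_dropb3 p (dropb3_of_point_curveFracTieZero p hPOINT hCURVEFRACTIEZERO))

end Summit.ResolutionOfSingularities.ResolutionOfSingularities.Cruxes.HypersurfaceCentreConstruction.LocalEngine

end
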